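import Literature.Computability.Complexity.IteratedAdditionBits
import Literature.Computability.Complexity.FoldBricks
import Literature.Computability.Complexity.PlumbingBricks
import HarnessLib

/-!
# Iterated addition of exponentially many long numbers inside the counting hierarchy

Fourth toolkit file (theorems only) of the scaled-up `FOM + MAJ` calculus. **Theorem**
(`iterSum_testBit_mem_CH`): if the bit predicate `{⟨u, j⟩ | bit (val j) of G u}` of a family of
(possibly exponentially long) numbers is in `CH`, then so is the bit predicate of the iterated
sums `x ↦ ∑_{i < 2^{p|x|}} G ⟨x, bin i⟩`. This is Bürgisser's Thm. 3.7(1) for nonnegative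
summands in the bit-predicate form ("Iterated addition … is well known to be in
Dlogtime-uniform `TC⁰` … By scaling up this result … we obtain the claim", ECCC TR06-113, p. 12),
proved here along the constant-depth algorithm of `IteratedAdditionBits.lean`
(Vollmer 1999, Thm. 1.20): block sums `T_β = ∑ᵢ (⌊Gᵢ/2^{Lβ}⌋ mod 2ᴸ)` are exponential sums of
WINDOWS (`windowGraph_mem_CH` + the sum rule), the even/odd block numbers `E`, `O` have readable
digits, and `E + O` is added by carry look-ahead (one `∃∀` over `CH` predicates).

Also: the sum rule with the summation range read off the first component of the base word
(`sumGraph_fst_mem_CH`), the form needed when the base word carries parameters.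

## References

* P. Bürgisser, ECCC TR06-113 (2006), Thm. 3.7(1) and its proof.
* H. Vollmer, *Introduction to Circuit Complexity* (1999), Thm. 1.20, §1.1.
* W. Hesse, E. Allender, D. A. M. Barrington, JCSS 65 (2002), §3 ("iterated addition is in FOM").
-/

namespace Literature.Computability.Complexity

open _root_.Computability Polynomial PRelSigma TTClosure Brick PPSharpP ThresholdPP Plumb Finset

/-! ### The sum rule with the range read off a component -/

section SumFst

variable {f : List Bool → ℕ} {q : Polynomial ℕ}

/-- **Sum rule, range from the first component**: if `f` has a `CH` graph and `f w < 2^{q|w|}`,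
then `u ↦ ∑_{i < 2^{p|fstP u|}} f ⟨u, bin i⟩` has a `CH` graph (cut the summand off at
`i < 2^{p|fstP u|}`, a `P` condition on `|bin i|`, and apply `sumGraph_mem_CH` over the larger
range `2^{p|u|}`). [cite: Burgisser2006, Theorem 3.7] -/
theorem sumGraph_fst_mem_CH (hf : {z | f (fstP z) = bitsToNat (sndP z)} ∈ CH)
    (hb : ∀ w, f w < 2 ^ q.eval w.length) (p : Polynomial ℕ) :
    {z | (∑ i ∈ range (2 ^ p.eval (fstP (fstP z)).length), f (boolPair (fstP z) (encodeNat i))) =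
      bitsToNat (sndP z)} ∈ CH := by
  -- the cut-off summand `f' w = if |sndP w| ≤ p |fstP (fstP w)| then f w else 0`
  have hC : ({w | (sndP w).length ≤ p.eval (fstP (fstP w)).length} : Language Bool) ∈ CH :=
    P_subset_CH (mem_P_of_iff (preimage_mem_P (LenLe_mem_P p)
      (pairFn_mem_FP (comp_mem_FP fstP_mem_FP fstP_mem_FP) sndP_mem_FP)) _ fun w => by
        change _ ↔ pairFn (fstP ∘ fstP) sndP w ∈ LenLe p
        rw [pairFn_apply, boolPair_mem_LenLe]; rfl)
  have hzero : {z | (fun _ : List Bool => (0 : ℕ)) (fstP z) = bitsToNat (sndP z)} ∈ CH :=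
    mem_CH_of_iff (P_subset_CH (preimage_mem_P valZero_mem_P sndP_mem_FP)) _ fun z => by
      change (0 : ℕ) = bitsToNat (sndP z) ↔ bitsToNat (sndP z) = 0
      exact eq_comm
  have hf' := iteGraph_mem_CH' hC (f := f) (g := fun _ => 0) hf hzero
  have hb' : ∀ w, (if (sndP w).length ≤ p.eval (fstP (fstP w)).length then f w else 0) < 2 ^ q.eval w.length :=
    fun w => by split_ifs; exacts [hb w, Nat.two_pow_pos _]
  refine mem_CH_of_iff (sumGraph_mem_CH hf' hb' p) _ fun z => ?_
  change _ ↔ (∑ i ∈ range (2 ^ p.eval (fstP z).length),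
    (if (sndP (boolPair (fstP z) (encodeNat i))).length ≤ p.eval (fstP (fstP (boolPair (fstP z) (encodeNat i)))).length
      then f (boolPair (fstP z) (encodeNat i)) else 0)) = bitsToNat (sndP z)
  simp only [sndP_boolPair, fstP_boolPair, Brick.length_encodeNat_le_iff]
  rw [← sum_filter]
  have hrange : (range (2 ^ p.eval (fstP z).length)).filter (fun i => i < 2 ^ p.eval (fstP (fstP z)).length) =
      range (2 ^ p.eval (fstP (fstP z)).length) := by
    ext i
    simp only [mem_filter, mem_range]
    have : 2 ^ p.eval (fstP (fstP z)).length ≤ 2 ^ p.eval (fstP z).length :=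
      Nat.pow_le_pow_right (by norm_num) (TM2Iter.eval_mono p (length_fstP_le (fstP z)))
    omega
  rw [hrange]
  rfl

end SumFst

/-! ### The block sums `T_β` as a `CH`-graph function -/

section Blocks

variable {G : List Bool → ℕ} (p : Polynomial ℕ)

/-- The recoding `⟨⟨x, β⟩, i⟩ ↦ ⟨⟨x, i⟩, ⟨bin (L · val β), 1ᴸ⟩⟩`, `L = p|x| + 1`, feeding the window
function. [folklore] -/
theorem blockIdxFn_mem_FP :
    pairFn (pairFn (fstP ∘ fstP) sndP)
      (pairFn (prodFn ∘ pairFn (lenBinF ∘ polyFn (p + 1) ∘ fstP ∘ fstP) (sndP ∘ fstP)) (polyFn (p + 1) ∘ fstP ∘ fstP)) ∈ FP :=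
  pairFn_mem_FP (pairFn_mem_FP (comp_mem_FP fstP_mem_FP fstP_mem_FP) sndP_mem_FP)
    (pairFn_mem_FP (comp_mem_FP prodFn_mem_FP (pairFn_mem_FP
      (comp_mem_FP lenBinF_mem_FP (comp_mem_FP (polyFn_mem_FP _) (comp_mem_FP fstP_mem_FP fstP_mem_FP)))
      (comp_mem_FP sndP_mem_FP fstP_mem_FP)))
      (comp_mem_FP (polyFn_mem_FP _) (comp_mem_FP fstP_mem_FP fstP_mem_FP)))

/-- The window function read after the recoding: on `w' = ⟨w, bin i⟩` it is
`⌊G ⟨fstP w, bin i⟩ / 2^{L · val (sndP w)}⌋ mod 2ᴸ`. [folklore] -/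
theorem window_blockIdx_apply (w : List Bool) (i : ℕ) :
    (fun u => G (fstP u) / 2 ^ bitsToNat (fstP (sndP u)) % 2 ^ (sndP (sndP u)).length)
      (pairFn (pairFn (fstP ∘ fstP) sndP)
        (pairFn (prodFn ∘ pairFn (lenBinF ∘ polyFn (p + 1) ∘ fstP ∘ fstP) (sndP ∘ fstP)) (polyFn (p + 1) ∘ fstP ∘ fstP))
        (boolPair w (encodeNat i))) =
      G (boolPair (fstP w) (encodeNat i)) / 2 ^ ((p.eval (fstP w).length + 1) * bitsToNat (sndP w)) %
        2 ^ (p.eval (fstP w).length + 1) := by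
  simp only [pairFn_apply, Function.comp_apply, fstP_boolPair, sndP_boolPair, prodFn_boolPair, polyFn_apply,
    lenBinF_apply, bitsToNat_encodeNat, List.length_replicate, eval_add, eval_one]

/-- **The block sums have a `CH` graph**: on words `w = ⟨x, β⟩`,
`T w = ∑_{i < 2^{p|x|}} (⌊G ⟨x, bin i⟩ / 2^{L · val β}⌋ mod 2ᴸ)`, `L = p|x| + 1`, is an exponential
sum of windows of the summands. [cite: Burgisser2006, Theorem 3.7] -/
theorem blockGraph_mem_CH (hG : {z | (G (fstP z)).testBit (bitsToNat (sndP z)) = true} ∈ CH) :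
    {z | (∑ i ∈ range (2 ^ p.eval (fstP (fstP z)).length),
        G (boolPair (fstP (fstP z)) (encodeNat i)) / 2 ^ ((p.eval (fstP (fstP z)).length + 1) * bitsToNat (sndP (fstP z))) %
          2 ^ (p.eval (fstP (fstP z)).length + 1)) = bitsToNat (sndP z)} ∈ CH := by
  obtain ⟨s, hs⟩ := exists_poly_length_le_of_mem_FP (blockIdxFn_mem_FP p)
  have hW := graph_comp_FP_mem_CH
    (f := fun u => G (fstP u) / 2 ^ bitsToNat (fstP (sndP u)) % 2 ^ (sndP (sndP u)).length)
    (windowGraph_mem_CH hG) (blockIdxFn_mem_FP p)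
  have hbW := bound_comp_FP
    (f := fun u => G (fstP u) / 2 ^ bitsToNat (fstP (sndP u)) % 2 ^ (sndP (sndP u)).length)
    (window_lt_two_pow G) hs
  refine mem_CH_of_iff (sumGraph_fst_mem_CH hW hbW p) _ fun z => ?_
  change _ ↔ (∑ i ∈ range (2 ^ p.eval (fstP (fstP z)).length), _) = bitsToNat (sndP z)
  simp only [window_blockIdx_apply]
  rfl

/-- **Bit-size of the block sums**: `T ⟨x, β⟩ < 2^{2L} ≤ 2^{(2p+2)|w|}`. [folklore] -/
theorem block_lt_two_pow (G : List Bool → ℕ) (w : List Bool) :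
    (∑ i ∈ range (2 ^ p.eval (fstP w).length),
        G (boolPair (fstP w) (encodeNat i)) / 2 ^ ((p.eval (fstP w).length + 1) * bitsToNat (sndP w)) %
          2 ^ (p.eval (fstP w).length + 1)) < 2 ^ (2 * p + 2).eval w.length := by
  refine (blockSum_lt (2 ^ p.eval (fstP w).length) (p.eval (fstP w).length + 1)
    (fun i => G (boolPair (fstP w) (encodeNat i))) (Nat.pow_le_pow_right (by norm_num) (Nat.le_succ _))
    (bitsToNat (sndP w))).trans_le (Nat.pow_le_pow_right (by norm_num) ?_)
  have := TM2Iter.eval_mono p (length_fstP_le w)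
  simp only [eval_add, eval_mul, eval_ofNat] at this ⊢
  omega

end Blocks

/-! ### The bits of the even and odd block numbers -/

section EvenOdd

variable {G : List Bool → ℕ} (p : Polynomial ℕ)

/-- The numeral of `2L = 2p|x| + 2` read off `z = ⟨x, t⟩`. [folklore] -/
theorem twoLFn_mem_FP : lenBinF ∘ polyFn (2 * p + 2) ∘ fstP ∈ FP :=
  comp_mem_FP lenBinF_mem_FP (comp_mem_FP (polyFn_mem_FP _) fstP_mem_FP)

/-- Its value. [folklore] -/
theorem twoLFn_val (z : List Bool) :
    bitsToNat ((lenBinF ∘ polyFn (2 * p + 2) ∘ fstP) z) = 2 * (p.eval (fstP z).length + 1) := by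
  simp only [Function.comp_apply, polyFn_apply, lenBinF_apply, bitsToNat_encodeNat, List.length_replicate,
    eval_add, eval_mul, eval_ofNat]
  ring

/-- The numeral of `L = p|x| + 1` read off `z = ⟨x, t⟩`. [folklore] -/
theorem LFn_mem_FP : lenBinF ∘ polyFn (p + 1) ∘ fstP ∈ FP :=
  comp_mem_FP lenBinF_mem_FP (comp_mem_FP (polyFn_mem_FP _) fstP_mem_FP)

/-- Its value. [folklore] -/
theorem LFn_val (z : List Bool) : bitsToNat ((lenBinF ∘ polyFn (p + 1) ∘ fstP) z) = p.eval (fstP z).length + 1 := by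
  simp only [Function.comp_apply, polyFn_apply, lenBinF_apply, bitsToNat_encodeNat, List.length_replicate,
    eval_add, eval_one]

/-- `val (bin 2) = 2`, `val (bin 1) = 1` as constant `FP` leaves. [folklore] -/
theorem bitsToNat_const_two : bitsToNat ((fun _ : List Bool => encodeNat 2) []) = 2 := bitsToNat_encodeNat 2

/-- **The bits of the even block number are a `CH` language**: on `z = ⟨x, t⟩`, with
`L = p|x| + 1` and the block sums `T ⟨x, β⟩`, the predicate "bit `val t mod 2L` of
`T ⟨x, bin (2 ⌊val t / 2L⌋)⟩`" is in `CH` (bits of a `CH`-graph function, read at a polynomial-time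
recoding). [cite: Burgisser2006, Theorem 3.7] -/
theorem evenBits_mem_CH (hG : {z | (G (fstP z)).testBit (bitsToNat (sndP z)) = true} ∈ CH) :
    {z | (∑ i ∈ range (2 ^ p.eval (fstP z).length),
        G (boolPair (fstP z) (encodeNat i)) /
          2 ^ ((p.eval (fstP z).length + 1) * (2 * (bitsToNat (sndP z) / (2 * (p.eval (fstP z).length + 1))))) %
          2 ^ (p.eval (fstP z).length + 1)).testBit (bitsToNat (sndP z) % (2 * (p.eval (fstP z).length + 1))) = true} ∈ CH := by
  have hTB := testBitGraph_mem_CH (blockGraph_mem_CH p hG) (block_lt_two_pow p G)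
  have hF : pairFn (pairFn fstP (prodFn ∘ pairFn (fun _ => encodeNat 2)
      (divFn ∘ pairFn sndP (lenBinF ∘ polyFn (2 * p + 2) ∘ fstP))))
      (remFn ∘ pairFn sndP (lenBinF ∘ polyFn (2 * p + 2) ∘ fstP)) ∈ FP :=
    pairFn_mem_FP (pairFn_mem_FP fstP_mem_FP (comp_mem_FP prodFn_mem_FP (pairFn_mem_FP (const_mem_FP _)
      (comp_mem_FP divFn_mem_FP (pairFn_mem_FP sndP_mem_FP (twoLFn_mem_FP p))))))
      (comp_mem_FP remFn_mem_FP (pairFn_mem_FP sndP_mem_FP (twoLFn_mem_FP p)))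
  refine mem_CH_of_iff (preimage_mem_CH hTB hF) _ fun z => ?_
  have h2 := twoLFn_val p z
  simp only [Function.comp_apply] at h2
  have key : ∀ (F : List Bool → List Bool) (w : List Bool),
      w ∈ F ⁻¹' {z | (∑ i ∈ range (2 ^ p.eval (fstP (fstP z)).length),
        G (boolPair (fstP (fstP z)) (encodeNat i)) / 2 ^ ((p.eval (fstP (fstP z)).length + 1) * bitsToNat (sndP (fstP z))) %
          2 ^ (p.eval (fstP (fstP z)).length + 1)).testBit (bitsToNat (sndP z)) = true} ↔
      (fun z => (∑ i ∈ range (2 ^ p.eval (fstP (fstP z)).length),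
        G (boolPair (fstP (fstP z)) (encodeNat i)) / 2 ^ ((p.eval (fstP (fstP z)).length + 1) * bitsToNat (sndP (fstP z))) %
          2 ^ (p.eval (fstP (fstP z)).length + 1)).testBit (bitsToNat (sndP z)) = true) (F w) := fun F w => Iff.rfl
  refine Iff.trans ?_ (key _ z).symm
  simp only [pairFn_apply, Function.comp_apply, fstP_boolPair, sndP_boolPair, prodFn_boolPair, divFn_boolPair,
    remFn_boolPair, bitsToNat_encodeNat, h2]
  exact Iff.rfl

/-- **The bits of the odd block number are a `CH` language**: on `z = ⟨x, t⟩`, the predicate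
"`L ≤ val t` and bit `(val t - L) mod 2L` of `T ⟨x, bin (2 ⌊(val t - L) / 2L⌋ + 1)⟩`" is in `CH`. [cite: Burgisser2006, Theorem 3.7] -/
theorem oddBits_mem_CH (hG : {z | (G (fstP z)).testBit (bitsToNat (sndP z)) = true} ∈ CH) :
    {z | p.eval (fstP z).length + 1 ≤ bitsToNat (sndP z) ∧
      (∑ i ∈ range (2 ^ p.eval (fstP z).length),
        G (boolPair (fstP z) (encodeNat i)) /
          2 ^ ((p.eval (fstP z).length + 1) *
            (2 * ((bitsToNat (sndP z) - (p.eval (fstP z).length + 1)) / (2 * (p.eval (fstP z).length + 1))) + 1)) %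
          2 ^ (p.eval (fstP z).length + 1)).testBit
        ((bitsToNat (sndP z) - (p.eval (fstP z).length + 1)) % (2 * (p.eval (fstP z).length + 1))) = true} ∈ CH := by
  have hTB := testBitGraph_mem_CH (blockGraph_mem_CH p hG) (block_lt_two_pow p G)
  -- `tL z = bin (val t - L)`
  have htL : subFn ∘ pairFn sndP (lenBinF ∘ polyFn (p + 1) ∘ fstP) ∈ FP :=
    comp_mem_FP subFn_mem_FP (pairFn_mem_FP sndP_mem_FP (LFn_mem_FP p))
  have hF : pairFn (pairFn fstP (addFn ∘ pairFn (prodFn ∘ pairFn (fun _ => encodeNat 2)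
      (divFn ∘ pairFn (subFn ∘ pairFn sndP (lenBinF ∘ polyFn (p + 1) ∘ fstP)) (lenBinF ∘ polyFn (2 * p + 2) ∘ fstP)))
      (fun _ => encodeNat 1)))
      (remFn ∘ pairFn (subFn ∘ pairFn sndP (lenBinF ∘ polyFn (p + 1) ∘ fstP)) (lenBinF ∘ polyFn (2 * p + 2) ∘ fstP)) ∈ FP :=
    pairFn_mem_FP (pairFn_mem_FP fstP_mem_FP (comp_mem_FP addFn_mem_FP (pairFn_mem_FP
      (comp_mem_FP prodFn_mem_FP (pairFn_mem_FP (const_mem_FP _)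
        (comp_mem_FP divFn_mem_FP (pairFn_mem_FP htL (twoLFn_mem_FP p))))) (const_mem_FP _))))
      (comp_mem_FP remFn_mem_FP (pairFn_mem_FP htL (twoLFn_mem_FP p)))
  have hLE : ({z | p.eval (fstP z).length + 1 ≤ bitsToNat (sndP z)} : Language Bool) ∈ Classes.P :=
    mem_P_of_iff (preimage_mem_P leVal_mem_P (pairFn_mem_FP (LFn_mem_FP p) sndP_mem_FP)) _ fun z => by
      change _ ↔ bitsToNat (fstP (pairFn (lenBinF ∘ polyFn (p + 1) ∘ fstP) sndP z)) ≤
        bitsToNat (sndP (pairFn (lenBinF ∘ polyFn (p + 1) ∘ fstP) sndP z))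
      rw [pairFn_apply, fstP_boolPair, sndP_boolPair, LFn_val]
      exact Iff.rfl
  refine mem_CH_of_iff (inter_P_mem_CH hLE (preimage_mem_CH hTB hF)) _ fun z => ?_
  rw [memL_inf']
  have h2 := twoLFn_val p z
  have h1 := LFn_val p z
  simp only [Function.comp_apply] at h2 h1
  refine and_congr Iff.rfl ?_
  have key : ∀ (F : List Bool → List Bool) (w : List Bool),
      w ∈ F ⁻¹' {z | (∑ i ∈ range (2 ^ p.eval (fstP (fstP z)).length),
        G (boolPair (fstP (fstP z)) (encodeNat i)) / 2 ^ ((p.eval (fstP (fstP z)).length + 1) * bitsToNat (sndP (fstP z))) %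
          2 ^ (p.eval (fstP (fstP z)).length + 1)).testBit (bitsToNat (sndP z)) = true} ↔
      (fun z => (∑ i ∈ range (2 ^ p.eval (fstP (fstP z)).length),
        G (boolPair (fstP (fstP z)) (encodeNat i)) / 2 ^ ((p.eval (fstP (fstP z)).length + 1) * bitsToNat (sndP (fstP z))) %
          2 ^ (p.eval (fstP (fstP z)).length + 1)).testBit (bitsToNat (sndP z)) = true) (F w) := fun F w => Iff.rfl
  refine Iff.trans ?_ (key _ z).symm
  simp only [pairFn_apply, Function.comp_apply, fstP_boolPair, sndP_boolPair, prodFn_boolPair, divFn_boolPair,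
    remFn_boolPair, addFn_boolPair, subFn_boolPair, bitsToNat_encodeNat, h2, h1]

end EvenOdd

/-! ### Carry look-ahead and the bits of the iterated sum -/

section Main

variable {G : List Bool → ℕ} (p : Polynomial ℕ)

/-- Triple exclusive or, unfolded into a proposition. [folklore] -/
theorem xor_xor_eq_true_iff (a b c : Bool) :
    ((a ^^ b) ^^ c) = true ↔
      ((((a = true ∧ ¬ b = true) ∨ (¬ a = true ∧ b = true)) ∧ ¬ c = true) ∨
        (¬ ((a = true ∧ ¬ b = true) ∨ (¬ a = true ∧ b = true)) ∧ c = true)) := by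
  cases a <;> cases b <;> cases c <;> simp

/-- **Iterated addition in the counting hierarchy** (Bürgisser 2006, Thm. 3.7(1), nonnegative
case, bit-predicate form). If `{⟨u, j⟩ | bit (val j) of G u} ∈ CH` then
`{⟨x, t⟩ | bit (val t) of ∑_{i < 2^{p|x|}} G ⟨x, bin i⟩} ∈ CH`: the bit is `eₜ ⊕ oₜ ⊕ carryₜ`
(`testBit_sum_eq_blocks`) where `eₜ, oₜ` are bits of the block sums (`evenBits_mem_CH`,
`oddBits_mem_CH`) and `carryₜ = ∃ s < t, eₛ ∧ oₛ ∧ ∀ u < t, s < u → eᵤ ∨ oᵤ` is first-order over them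
(`exists_lt_mem_CH`, `forall_lt_mem_CH`). ("Iterated addition … is in Dlogtime-uniform `TC⁰` …
By scaling up this result as in the proof of Theorem 3.4, we obtain the claim.") [cite: Burgisser2006, Theorem 3.7] -/
theorem iterSum_testBit_mem_CH (hG : {z | (G (fstP z)).testBit (bitsToNat (sndP z)) = true} ∈ CH) :
    {z | (∑ i ∈ range (2 ^ p.eval (fstP z).length), G (boolPair (fstP z) (encodeNat i))).testBit (bitsToNat (sndP z)) =
      true} ∈ CH := by
  -- the even / odd bit functions of a base word `x`
  set eF : List Bool → ℕ → Bool := fun x t =>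
    (∑ i ∈ range (2 ^ p.eval x.length), G (boolPair x (encodeNat i)) /
      2 ^ ((p.eval x.length + 1) * (2 * (t / (2 * (p.eval x.length + 1))))) % 2 ^ (p.eval x.length + 1)).testBit
      (t % (2 * (p.eval x.length + 1))) with heF
  set oF : List Bool → ℕ → Bool := fun x t =>
    decide (p.eval x.length + 1 ≤ t) &&
      (∑ i ∈ range (2 ^ p.eval x.length), G (boolPair x (encodeNat i)) /
        2 ^ ((p.eval x.length + 1) * (2 * ((t - (p.eval x.length + 1)) / (2 * (p.eval x.length + 1))) + 1)) %
          2 ^ (p.eval x.length + 1)).testBit ((t - (p.eval x.length + 1)) % (2 * (p.eval x.length + 1))) with hoF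
  have hE : {z | eF (fstP z) (bitsToNat (sndP z)) = true} ∈ CH := evenBits_mem_CH p hG
  have hO : {z | oF (fstP z) (bitsToNat (sndP z)) = true} ∈ CH :=
    mem_CH_of_iff (oddBits_mem_CH p hG) _ fun z => by
      change (decide _ && _) = true ↔ _ ∧ _
      rw [Bool.and_eq_true, decide_eq_true_iff]
  -- readers of `x` and of an index at various depths
  have hE1 : {w | eF (fstP (fstP w)) (bitsToNat (sndP w)) = true} ∈ CH :=
    mem_CH_of_iff (preimage_mem_CH hE (pairFn_mem_FP (comp_mem_FP fstP_mem_FP fstP_mem_FP) sndP_mem_FP)) _ fun w => by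
      change _ ↔ eF (fstP (pairFn (fstP ∘ fstP) sndP w)) (bitsToNat (sndP (pairFn (fstP ∘ fstP) sndP w))) = true
      rw [pairFn_apply, fstP_boolPair, sndP_boolPair]; rfl
  have hO1 : {w | oF (fstP (fstP w)) (bitsToNat (sndP w)) = true} ∈ CH :=
    mem_CH_of_iff (preimage_mem_CH hO (pairFn_mem_FP (comp_mem_FP fstP_mem_FP fstP_mem_FP) sndP_mem_FP)) _ fun w => by
      change _ ↔ oF (fstP (pairFn (fstP ∘ fstP) sndP w)) (bitsToNat (sndP (pairFn (fstP ∘ fstP) sndP w))) = true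
      rw [pairFn_apply, fstP_boolPair, sndP_boolPair]; rfl
  have hE2 : {w | eF (fstP (fstP (fstP w))) (bitsToNat (sndP w)) = true} ∈ CH :=
    mem_CH_of_iff (preimage_mem_CH hE (pairFn_mem_FP (comp_mem_FP fstP_mem_FP (comp_mem_FP fstP_mem_FP fstP_mem_FP))
      sndP_mem_FP)) _ fun w => by
      change _ ↔ eF (fstP (pairFn (fstP ∘ fstP ∘ fstP) sndP w)) (bitsToNat (sndP (pairFn (fstP ∘ fstP ∘ fstP) sndP w))) = true
      rw [pairFn_apply, fstP_boolPair, sndP_boolPair]; rfl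
  have hO2 : {w | oF (fstP (fstP (fstP w))) (bitsToNat (sndP w)) = true} ∈ CH :=
    mem_CH_of_iff (preimage_mem_CH hO (pairFn_mem_FP (comp_mem_FP fstP_mem_FP (comp_mem_FP fstP_mem_FP fstP_mem_FP))
      sndP_mem_FP)) _ fun w => by
      change _ ↔ oF (fstP (pairFn (fstP ∘ fstP ∘ fstP) sndP w)) (bitsToNat (sndP (pairFn (fstP ∘ fstP ∘ fstP) sndP w))) = true
      rw [pairFn_apply, fstP_boolPair, sndP_boolPair]; rfl
  -- `u < t`, `s < u` on `w'' = ⟨⟨z, s⟩, u⟩`, and `s < t` on `w' = ⟨z, s⟩`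
  have hLTut : ({w | bitsToNat (sndP w) < bitsToNat (sndP (fstP (fstP w)))} : Language Bool) ∈ CH :=
    P_subset_CH (mem_P_of_iff (preimage_mem_P ltVal_mem_P (pairFn_mem_FP sndP_mem_FP
      (comp_mem_FP sndP_mem_FP (comp_mem_FP fstP_mem_FP fstP_mem_FP)))) _ fun w => by
        change _ ↔ bitsToNat (fstP (pairFn sndP (sndP ∘ fstP ∘ fstP) w)) < bitsToNat (sndP (pairFn sndP (sndP ∘ fstP ∘ fstP) w))
        rw [pairFn_apply, fstP_boolPair, sndP_boolPair]; rfl)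
  have hLTsu : ({w | bitsToNat (sndP (fstP w)) < bitsToNat (sndP w)} : Language Bool) ∈ CH :=
    P_subset_CH (mem_P_of_iff (preimage_mem_P ltVal_mem_P (pairFn_mem_FP (comp_mem_FP sndP_mem_FP fstP_mem_FP) sndP_mem_FP))
      _ fun w => by
        change _ ↔ bitsToNat (fstP (pairFn (sndP ∘ fstP) sndP w)) < bitsToNat (sndP (pairFn (sndP ∘ fstP) sndP w))
        rw [pairFn_apply, fstP_boolPair, sndP_boolPair]; rfl)
  have hLT1 : ({w | bitsToNat (sndP w) < bitsToNat (sndP (fstP w))} : Language Bool) ∈ CH :=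
    P_subset_CH (mem_P_of_iff (preimage_mem_P ltVal_mem_P (pairFn_mem_FP sndP_mem_FP (comp_mem_FP sndP_mem_FP fstP_mem_FP)))
      _ fun w => by
        change _ ↔ bitsToNat (fstP (pairFn sndP (sndP ∘ fstP) w)) < bitsToNat (sndP (pairFn sndP (sndP ∘ fstP) w))
        rw [pairFn_apply, fstP_boolPair, sndP_boolPair]; rfl)
  -- the carry language
  have hInner2 := union_mem_CH (compl_mem_CH hLTut) (union_mem_CH (compl_mem_CH hLTsu) (union_mem_CH hE2 hO2))
  have hForall := forall_lt_mem_CH hInner2 X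
  have hInner := inter_mem_CH hLT1 (inter_mem_CH hE1 (inter_mem_CH hO1 hForall))
  have hCarry := exists_lt_mem_CH hInner X
  -- the carry language together with its semantics
  obtain ⟨C, hCmem, hCiff⟩ : ∃ C : Language Bool, C ∈ CH ∧ ∀ z : List Bool, z ∈ C ↔
      ∃ s < bitsToNat (sndP z), (eF (fstP z) s = true ∧ oF (fstP z) s = true) ∧
        ∀ u < bitsToNat (sndP z), s < u → (eF (fstP z) u = true ∨ oF (fstP z) u = true) := by
    refine ⟨_, hCarry, fun z => ?_⟩
    have hzt : bitsToNat (sndP z) < 2 ^ z.length := by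
      have h1 := length_fstF_sndF_le z
      change 2 * (fstP z).length + (sndP z).length ≤ _ at h1
      exact (bitsToNat_lt _).trans_le (Nat.pow_le_pow_right (by norm_num) (by omega))
    change (∃ v < 2 ^ (X : Polynomial ℕ).eval z.length,
      bitsToNat (sndP (boolPair z (encodeNat v))) < bitsToNat (sndP (fstP (boolPair z (encodeNat v)))) ∧
        (eF (fstP (fstP (boolPair z (encodeNat v)))) (bitsToNat (sndP (boolPair z (encodeNat v)))) = true ∧
          (oF (fstP (fstP (boolPair z (encodeNat v)))) (bitsToNat (sndP (boolPair z (encodeNat v)))) = true ∧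
            ∀ u < 2 ^ (X : Polynomial ℕ).eval (boolPair z (encodeNat v)).length,
              (¬ bitsToNat (sndP (boolPair (boolPair z (encodeNat v)) (encodeNat u))) <
                  bitsToNat (sndP (fstP (fstP (boolPair (boolPair z (encodeNat v)) (encodeNat u))))) ∨
                (¬ bitsToNat (sndP (fstP (boolPair (boolPair z (encodeNat v)) (encodeNat u)))) <
                    bitsToNat (sndP (boolPair (boolPair z (encodeNat v)) (encodeNat u))) ∨
                  (eF (fstP (fstP (fstP (boolPair (boolPair z (encodeNat v)) (encodeNat u)))))
                      (bitsToNat (sndP (boolPair (boolPair z (encodeNat v)) (encodeNat u)))) = true ∨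
                    oF (fstP (fstP (fstP (boolPair (boolPair z (encodeNat v)) (encodeNat u)))))
                      (bitsToNat (sndP (boolPair (boolPair z (encodeNat v)) (encodeNat u)))) = true)))))) ↔ _
    simp only [fstP_boolPair, sndP_boolPair, bitsToNat_encodeNat, eval_X]
    constructor
    · rintro ⟨s, -, hst, hes, hos, hall⟩
      refine ⟨s, hst, ⟨hes, hos⟩, fun u hut hsu => ?_⟩
      have hu : u < 2 ^ (boolPair z (encodeNat s)).length :=
        hut.trans (hzt.trans_le (Nat.pow_le_pow_right (by norm_num) (by rw [length_boolPair]; omega)))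
      rcases hall u hu with h | h | h
      · exact absurd hut h
      · exact absurd hsu h
      · exact h
    · rintro ⟨s, hst, ⟨hes, hos⟩, hall⟩
      refine ⟨s, hst.trans hzt, hst, hes, hos, fun u _ => ?_⟩
      by_cases hut : u < bitsToNat (sndP z)
      · by_cases hsu : s < u
        · exact Or.inr (Or.inr (hall u hut hsu))
        · exact Or.inr (Or.inl hsu)
      · exact Or.inl hut
  -- the final Boolean combination `(E Δ O) Δ Carry`
  have hX := union_mem_CH (inter_mem_CH hE (compl_mem_CH hO)) (inter_mem_CH (compl_mem_CH hE) hO)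
  refine mem_CH_of_iff (union_mem_CH (inter_mem_CH hX (compl_mem_CH hCmem)) (inter_mem_CH (compl_mem_CH hX) hCmem)) _
    fun z => ?_
  rw [memL_sup, memL_inf', memL_inf', memL_compl, memL_compl, memL_sup, memL_inf', memL_inf', memL_compl, memL_compl,
    hCiff z]
  change _ = true ↔ ((eF (fstP z) (bitsToNat (sndP z)) = true ∧ ¬ oF (fstP z) (bitsToNat (sndP z)) = true ∨
      ¬ eF (fstP z) (bitsToNat (sndP z)) = true ∧ oF (fstP z) (bitsToNat (sndP z)) = true) ∧
      ¬ (∃ s < bitsToNat (sndP z), (eF (fstP z) s = true ∧ oF (fstP z) s = true) ∧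
        ∀ u < bitsToNat (sndP z), s < u → (eF (fstP z) u = true ∨ oF (fstP z) u = true)) ∨
    ¬ (eF (fstP z) (bitsToNat (sndP z)) = true ∧ ¬ oF (fstP z) (bitsToNat (sndP z)) = true ∨
      ¬ eF (fstP z) (bitsToNat (sndP z)) = true ∧ oF (fstP z) (bitsToNat (sndP z)) = true) ∧
      ∃ s < bitsToNat (sndP z), (eF (fstP z) s = true ∧ oF (fstP z) s = true) ∧
        ∀ u < bitsToNat (sndP z), s < u → (eF (fstP z) u = true ∨ oF (fstP z) u = true))
  rw [testBit_sum_eq_blocks (2 ^ p.eval (fstP z).length) (p.eval (fstP z).length + 1)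
      (fun i => G (boolPair (fstP z) (encodeNat i))) (Nat.succ_pos _)
      (Nat.pow_le_pow_right (by norm_num) (Nat.le_succ _)) (eF (fstP z)) (oF (fstP z)) (fun t => rfl) (fun t => rfl),
    xor_xor_eq_true_iff, decide_eq_true_iff]

end Main

end Literature.Computability.Complexity
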